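import Mathlib.Analysis.CStarAlgebra.Matrix
import Mathlib.Analysis.Matrix.Normed
import Mathlib.LinearAlgebra.Matrix.Kronecker
import Mathlib.Analysis.SpecialFunctions.Sqrt
import Mathlib.Algebra.Order.BigOperators.Ring.Finset
import Literature.MathematicalPhysics.QuantumLattice.LieTrotter
import HarnessLib

/-!
# The Dyson–Lieb–Simon trace inequality for exponentials of Kronecker sums

Trunk T-QLATTICE (matrix analysis behind the quantum-lattice statements; consumer: Gaussian
domination at positive temperature for the hard-core lattice gas,
`Literature/Barriers/AtomisticToContinuum/HalfFillingGaussianDomination.lean`, and through it the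
thermal infrared bound `Literature.Barriers.AtomisticToContinuum.BoseGas.hc_infraredBound_thermal`).

The quantum substitute for the classical Gaussian-domination Schwarz inequality is
[DLS1978] Lemma 4.1 (eq. (45)): for real matrices `A, B, Cᵢ, Dᵢ`,
`Tr exp(A⊗1 + 1⊗B - Σᵢ(Cᵢ⊗1 - 1⊗Dᵢ)²)² ≤ Tr exp(A⊗1 + 1⊗A - Σᵢ(Cᵢ⊗1 - 1⊗Cᵢ)²) ·
Tr exp(B⊗1 + 1⊗B - Σᵢ(Dᵢ⊗1 - 1⊗Dᵢ)²)`. Expanding the squares (the two factors commute) this is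
the statement proved here (`Matrix.trace_exp_kroneckerSum_le`): for real square matrices
`A, Mᵢ` (size `m`) and `B, Nᵢ` (size `n`),

`Tr exp(A⊗1 + 1⊗B + Σᵢ Mᵢ⊗Nᵢ) ≤ (Tr exp(A⊗1 + 1⊗A + Σᵢ Mᵢ⊗Mᵢ))^{1/2} (Tr exp(B⊗1 + 1⊗B + Σᵢ Nᵢ⊗Nᵢ))^{1/2}`.

## The proof

[DLS1978] prove (45) with the Trotter product formula, the Gaussian linearisation
`e^{-D²} = (4π)^{-1/2}∫e^{ikD}e^{-k²/4}dk`, the factorisation `Tr_{H⊗H}(X⊗Y) = Tr X · Tr Y` with the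
reality of all matrices, and the Schwarz inequality in the `k`-integration. We follow the
variant printed in [LSSY2005] Ch. 11 (11.5)–(11.7) for reflection positivity, where the Trotter
factors of the crossing terms are the *linear* approximants `1 + (β/2n)Σ(S⁺θS⁺ + S⁻θS⁻)`, so that
the `n`-th approximant "is a sum of terms of the form `Πᵢ Aᵢ θAᵢ`" with real `Aᵢ` and the trace
factorises term by term into `|Tr_L FΠAᵢ|²`-type products; no Gaussian integral is needed:

* `tendsto_pow_exp_of_norm_sub_le` — an Euler–Lie product formula in a Banach algebra:
  if `‖F_N - (1 + z/N)‖ ≤ C/N²` then `F_N^N → exp z` (telescoping, as in `LieTrotter.lean`);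
* `sum_pow_eq_sum_ofFn_prod` — `(Σₐ Tₐ)^N = Σ_{c : Fin N → ·} T_{c₀} ⋯ T_{c_{N-1}}` in any
  semiring, and `Matrix.ofFn_prod_kronecker` — ordered products of Kronecker products;
* `Matrix.trace_pow_kroneckerSum_le` — **the trace Schwarz inequality for powers**: for real
  `Xₐ, Yₐ`, `Tr (ΣₐXₐ⊗Yₐ)^N ≤ (Tr (ΣₐXₐ⊗Xₐ)^N)^{1/2} (Tr (ΣₐYₐ⊗Yₐ)^N)^{1/2}` (expand, factorise
  the traces, Cauchy–Schwarz over the words `c`);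
* `Matrix.trace_exp_kroneckerSum_le` — the limit `N → ∞` with the approximants
  `Xₐ ∈ {1 + A/N} ∪ {N^{-1/2}Mᵢ}`, `Yₐ ∈ {1 + B/N} ∪ {N^{-1/2}Nᵢ}`.

"Real matrix" is expressed, as in `XYOrderGDProofs.lean`, by `Xᵀ = Xᴴ`.

## References

* [DLS1978] F. J. Dyson, E. H. Lieb, B. Simon, *Phase transitions in quantum spin systems with
  isotropic and nonisotropic interactions*, J. Stat. Phys. 18 (1978) 335–383, Lemma 4.1,
  eqs. (45)–(47).
* [LSSY2005] E. H. Lieb, R. Seiringer, J. P. Solovej, J. Yngvason, *The Mathematics of the Bose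
  Gas and its Condensation*, Oberwolfach Seminars 34, Birkhäuser 2005 (arXiv:cond-mat/0610117),
  Ch. 11, (11.5)–(11.7) and (11.14)–(11.19).
* M. Reed, B. Simon, *Methods of Modern Mathematical Physics I*, Theorem VIII.29 (product
  formula).
-/

noncomputable section

open NormedSpace Filter Topology Finset
open scoped Kronecker

namespace Literature.MathematicalPhysics.QuantumLattice

/-! ### An Euler–Lie product formula with an `O(N⁻²)` defect -/

section Euler

variable {𝕂 𝔸 : Type*} [RCLike 𝕂] [NormedRing 𝔸] [NormedAlgebra 𝕂 𝔸]

variable [NormOneClass 𝔸] [CompleteSpace 𝔸]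

/-- **Product formula with rate.** In a Banach algebra with `‖1‖ = 1`: if
`‖F_N - (1 + z/N)‖ ≤ C/N²` for all `N ≥ 1` (`C ≥ 0`), then
`‖F_N^N - exp z‖ ≤ e^{‖z‖ + C} (C + ‖z‖² e^{‖z‖}) / N`. With `Y = exp(z/N)`: `Y^N = exp z`,
`‖F_N - Y‖ ≤ (C + ‖z‖²e^{‖z‖})/N²`, `‖F_N‖, ‖Y‖ ≤ e^{(‖z‖+C)/N}`, and the telescoping estimate
`norm_pow_sub_pow_le'`. Reed–Simon I, proof of Theorem VIII.29 (Euler factors in place of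
exponential factors; [LSSY2005] Ch. 11 (11.5)). [cite: ReedSimonI1980, Theorem VIII.29] -/
theorem norm_pow_sub_exp_le_of_norm_sub_le (z : 𝔸) {F : ℕ → 𝔸} {C : ℝ} (hC : 0 ≤ C)
    (hF : ∀ N : ℕ, N ≠ 0 → ‖F N - (1 + (N : 𝕂)⁻¹ • z)‖ ≤ C / (N : ℝ) ^ 2) {N : ℕ} (hN : N ≠ 0) :
    ‖F N ^ N - exp z‖ ≤ Real.exp (‖z‖ + C) * (C + ‖z‖ ^ 2 * Real.exp ‖z‖) / N := by
  letI : NormedAlgebra ℚ 𝔸 := NormedAlgebra.restrictScalars ℚ 𝕂 𝔸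
  obtain ⟨n, rfl⟩ : ∃ n, N = n + 1 := Nat.exists_eq_succ_of_ne_zero hN
  have hNpos : (0 : ℝ) < (n + 1 : ℕ) := by positivity
  have hN1 : (1 : ℝ) ≤ (n + 1 : ℕ) := by exact_mod_cast Nat.succ_le_succ (Nat.zero_le n)
  set r : ℝ := ‖z‖ with hr_def
  have hr0 : 0 ≤ r := norm_nonneg z
  set x : 𝔸 := ((n + 1 : ℕ) : 𝕂)⁻¹ • z with hx_def
  have hx : ‖x‖ ≤ r / (n + 1 : ℕ) := norm_inv_natCast_smul_le z (n + 1)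
  have hx' : ‖x‖ ≤ r := hx.trans (div_le_self hr0 hN1)
  set X : 𝔸 := F (n + 1) with hX_def
  set Y : 𝔸 := exp x with hY_def
  -- `Y^N = exp z`
  have hYN : Y ^ (n + 1) = exp z := by
    rw [hY_def, ← exp_nsmul, hx_def, ← Nat.cast_smul_eq_nsmul 𝕂, smul_smul,
      mul_inv_cancel₀ (by exact_mod_cast hN), one_smul]
  -- the one-step estimate
  set K : ℝ := C + r ^ 2 * Real.exp r with hK_def
  have hK0 : 0 ≤ K := by positivity
  have hXY : ‖X - Y‖ ≤ K / (n + 1 : ℕ) ^ 2 := by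
    have h1 : ‖X - (1 + x)‖ ≤ C / (n + 1 : ℕ) ^ 2 := hF (n + 1) hN
    have h2 : ‖(1 + x) - Y‖ ≤ r ^ 2 * Real.exp r / (n + 1 : ℕ) ^ 2 := by
      rw [← norm_neg, neg_sub, show Y - (1 + x) = exp x - 1 - x by rw [hY_def]; abel]
      calc ‖exp x - 1 - x‖ ≤ ‖x‖ ^ 2 * Real.exp ‖x‖ := norm_exp_sub_one_sub_le 𝕂 x
        _ ≤ (r / (n + 1 : ℕ)) ^ 2 * Real.exp r := by gcongr
        _ = r ^ 2 * Real.exp r / (n + 1 : ℕ) ^ 2 := by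
            field_simp
    calc ‖X - Y‖ = ‖(X - (1 + x)) + ((1 + x) - Y)‖ := by rw [sub_add_sub_cancel]
      _ ≤ ‖X - (1 + x)‖ + ‖(1 + x) - Y‖ := norm_add_le _ _
      _ ≤ C / (n + 1 : ℕ) ^ 2 + r ^ 2 * Real.exp r / (n + 1 : ℕ) ^ 2 := add_le_add h1 h2
      _ = K / (n + 1 : ℕ) ^ 2 := by rw [hK_def, add_div]
  -- norms of `X`, `Y`
  set M : ℝ := Real.exp ((r + C) / (n + 1 : ℕ)) with hM_def
  have hYM : ‖Y‖ ≤ M :=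
    calc ‖Y‖ ≤ Real.exp ‖x‖ := norm_exp_le 𝕂 x
      _ ≤ M := Real.exp_le_exp.mpr (hx.trans (by gcongr; linarith))
  have hXM : ‖X‖ ≤ M := by
    have h1 : ‖X - (1 + x)‖ ≤ C / (n + 1 : ℕ) ^ 2 := hF (n + 1) hN
    have hC2 : C / (n + 1 : ℕ) ^ 2 ≤ C / (n + 1 : ℕ) := by
      refine div_le_div_of_nonneg_left hC hNpos ?_
      calc ((n + 1 : ℕ) : ℝ) = (n + 1 : ℕ) * 1 := (mul_one _).symm
        _ ≤ (n + 1 : ℕ) * (n + 1 : ℕ) := by gcongr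
        _ = ((n + 1 : ℕ) : ℝ) ^ 2 := (sq _).symm
    calc ‖X‖ = ‖(X - (1 + x)) + (1 + x)‖ := by rw [sub_add_cancel]
      _ ≤ ‖X - (1 + x)‖ + ‖(1 : 𝔸) + x‖ := norm_add_le _ _
      _ ≤ ‖X - (1 + x)‖ + (‖(1 : 𝔸)‖ + ‖x‖) := by gcongr; exact norm_add_le _ _
      _ ≤ C / (n + 1 : ℕ) + (1 + r / (n + 1 : ℕ)) := by
          rw [norm_one]
          exact add_le_add (h1.trans hC2) (by gcongr)
      _ = (r + C) / (n + 1 : ℕ) + 1 := by rw [add_div]; ring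
      _ ≤ M := Real.add_one_le_exp _
  have hMn : M ^ n ≤ Real.exp (r + C) := by
    rw [hM_def, ← Real.exp_nat_mul]
    apply Real.exp_le_exp.mpr
    have h1 : (n : ℝ) * ((r + C) / (n + 1 : ℕ)) = (r + C) * (n / (n + 1 : ℕ)) := by ring
    rw [h1]
    apply mul_le_of_le_one_right (by positivity)
    rw [div_le_one hNpos]
    exact_mod_cast Nat.le_succ n
  -- telescoping
  have htel := norm_pow_sub_pow_le' X Y hXM hYM n
  rw [hYN] at htel
  calc ‖X ^ (n + 1) - exp z‖ ≤ (n + 1) * M ^ n * ‖X - Y‖ := htel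
    _ ≤ (n + 1) * Real.exp (r + C) * (K / (n + 1 : ℕ) ^ 2) := by gcongr
    _ = Real.exp (r + C) * K / (n + 1 : ℕ) := by
        field_simp
        push_cast
        ring

/-- **Euler–Lie product formula**: in a Banach algebra with `‖1‖ = 1`, if
`‖F_N - (1 + z/N)‖ ≤ C/N²` for `N ≥ 1` then `F_N^N → exp z` (`N → ∞`). This is the product
formula behind the Trotter approximants with linear factors `1 + (β/2n)Σ(S⁺θS⁺ + S⁻θS⁻)` of
[LSSY2005] Ch. 11 (11.5). Reed–Simon I, Theorem VIII.29. [cite: ReedSimonI1980, Theorem VIII.29]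
[cite: LSSY2005, Ch. 11 (11.5)] -/
theorem tendsto_pow_exp_of_norm_sub_le (z : 𝔸) {F : ℕ → 𝔸} {C : ℝ}
    (hF : ∀ N : ℕ, N ≠ 0 → ‖F N - (1 + (N : 𝕂)⁻¹ • z)‖ ≤ C / (N : ℝ) ^ 2) :
    Tendsto (fun N : ℕ => F N ^ N) atTop (𝓝 (exp z)) := by
  have hC : 0 ≤ C := by
    have h := hF 1 one_ne_zero
    simp only [Nat.cast_one, one_pow, div_one] at h
    exact (norm_nonneg _).trans h
  set K : ℝ := Real.exp (‖z‖ + C) * (C + ‖z‖ ^ 2 * Real.exp ‖z‖)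
  rw [tendsto_iff_norm_sub_tendsto_zero]
  refine squeeze_zero_norm' ?_ (tendsto_const_div_atTop_nhds_zero_nat K)
  filter_upwards [eventually_ne_atTop 0] with N hN
  rw [Real.norm_of_nonneg (norm_nonneg _)]
  exact norm_pow_sub_exp_le_of_norm_sub_le (𝕂 := 𝕂) z hC hF hN

end Euler

/-! ### Powers of a finite sum in a semiring: expansion into ordered words -/

section Words

variable {R : Type*} [Semiring R] {C : Type*} [Fintype C]

/-- **Noncommutative multinomial expansion**: `(Σₐ Tₐ)^N = Σ_{c : Fin N → C} T_{c 0} T_{c 1} ⋯ T_{c (N-1)}`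
(ordered products, written as `List.prod` of `List.ofFn`). [folklore] -/
theorem sum_pow_eq_sum_ofFn_prod (T : C → R) (N : ℕ) :
    (∑ a, T a) ^ N = ∑ c : Fin N → C, (List.ofFn fun k => T (c k)).prod := by
  induction N with
  | zero => simp
  | succ N ih =>
    rw [pow_succ', ih, Finset.sum_mul_sum, ← Finset.sum_product', Finset.univ_product_univ,
      ← (Fin.consEquiv fun _ : Fin (N + 1) => C).sum_comp]
    refine Fintype.sum_congr _ _ fun p => ?_
    rcases p with ⟨a, c⟩
    simp only [Fin.consEquiv_apply, List.ofFn_succ, Fin.cons_zero, Fin.cons_succ, List.prod_cons]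

end Words

end Literature.MathematicalPhysics.QuantumLattice

/-! ### Real matrices, ordered products and Kronecker products -/

namespace Matrix

open Literature.MathematicalPhysics.QuantumLattice

variable {m n : Type*} [Fintype m] [Fintype n]

/-- A real matrix (`Xᵀ = Xᴴ`) has real trace: `(Tr X).im = 0`. [folklore] -/
theorem trace_im_of_transpose_eq_conjTranspose {X : Matrix m m ℂ} (hX : Xᵀ = Xᴴ) :
    X.trace.im = 0 := by
  have h : ∀ i, (X i i).im = 0 := by
    intro i
    have hi := congrFun (congrFun hX i) i
    rw [transpose_apply, conjTranspose_apply, Complex.star_def] at hi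
    have := congrArg Complex.im hi
    rw [Complex.conj_im] at this
    linarith
  rw [trace, Complex.im_sum]
  exact sum_eq_zero fun i _ => h i

/-- A real matrix has trace `Tr X = ((Tr X).re : ℂ)`. [folklore] -/
theorem trace_eq_ofReal_re_of_transpose_eq_conjTranspose {X : Matrix m m ℂ} (hX : Xᵀ = Xᴴ) :
    X.trace = ((X.trace.re : ℝ) : ℂ) :=
  Complex.ext (by simp) (by rw [Complex.ofReal_im]; exact trace_im_of_transpose_eq_conjTranspose hX)

/-- Ordered products of real matrices are real. [folklore] -/
theorem ofFn_prod_transpose_eq_conjTranspose [DecidableEq m] {N : ℕ} {P : Fin N → Matrix m m ℂ}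
    (hP : ∀ k, (P k)ᵀ = (P k)ᴴ) : ((List.ofFn P).prod)ᵀ = ((List.ofFn P).prod)ᴴ := by
  induction N with
  | zero => simp
  | succ N ih =>
    rw [List.ofFn_succ, List.prod_cons, transpose_mul, conjTranspose_mul, hP 0,
      ih (fun k => hP k.succ)]

/-- **Ordered products of Kronecker products**: `Πₖ (Pₖ ⊗ Qₖ) = (Πₖ Pₖ) ⊗ (Πₖ Qₖ)`
(`mul_kronecker_mul`). [folklore] -/
theorem ofFn_prod_kronecker [DecidableEq m] [DecidableEq n] {N : ℕ} (P : Fin N → Matrix m m ℂ)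
    (Q : Fin N → Matrix n n ℂ) :
    (List.ofFn fun k => P k ⊗ₖ Q k).prod = (List.ofFn P).prod ⊗ₖ (List.ofFn Q).prod := by
  induction N with
  | zero => simp
  | succ N ih =>
    rw [List.ofFn_succ, List.ofFn_succ, List.ofFn_succ, List.prod_cons, List.prod_cons,
      List.prod_cons, ih, ← mul_kronecker_mul]

/-! ### The trace Schwarz inequality for powers of a sum of Kronecker products -/

/-- **Trace Schwarz inequality for separable sums** (the algebraic core of [DLS1978] Lemma 4.1,
in the form of [LSSY2005] (11.6)–(11.7): "`𝒵ₙ` is a sum of terms `Πᵢ AᵢθAᵢ` … all the `Aᵢ` are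
real matrices, and therefore `Tr_H FθF̄ ΠAᵢθAᵢ = |Tr_L FΠAᵢ|² ≥ 0`"): for finite families of REAL
square matrices `Xₐ` (size `m`) and `Yₐ` (size `n`) and every `N`,
`Re Tr (Σₐ Xₐ⊗Yₐ)^N ≤ (Re Tr (Σₐ Xₐ⊗Xₐ)^N)^{1/2} (Re Tr (Σₐ Yₐ⊗Yₐ)^N)^{1/2}`.
Proof: expand the powers into words `c : Fin N → C`; `Tr(ΠX_{cₖ} ⊗ ΠY_{cₖ}) = p_c q_c` with real
`p_c = Tr ΠX_{cₖ}`, `q_c = Tr ΠY_{cₖ}`; then `Σ p_c q_c ≤ (Σp_c²)^{1/2}(Σq_c²)^{1/2}`.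
[cite: DLS1978, Lemma 4.1, eq. (47)] [cite: LSSY2005, Ch. 11 (11.6)–(11.7)] -/
theorem trace_pow_kroneckerSum_le [DecidableEq m] [DecidableEq n] {C : Type*} [Fintype C]
    {X : C → Matrix m m ℂ} {Y : C → Matrix n n ℂ} (hX : ∀ a, (X a)ᵀ = (X a)ᴴ)
    (hY : ∀ a, (Y a)ᵀ = (Y a)ᴴ) (N : ℕ) :
    (((∑ a, X a ⊗ₖ Y a) ^ N).trace).re ≤
      Real.sqrt (((∑ a, X a ⊗ₖ X a) ^ N).trace).re *
        Real.sqrt (((∑ a, Y a ⊗ₖ Y a) ^ N).trace).re := by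
  -- the real traces of the words
  set p : (Fin N → C) → ℝ := fun c => ((List.ofFn fun k => X (c k)).prod.trace).re with hp
  set q : (Fin N → C) → ℝ := fun c => ((List.ofFn fun k => Y (c k)).prod.trace).re with hq
  have hpC : ∀ c : Fin N → C, (List.ofFn fun k => X (c k)).prod.trace = (p c : ℂ) := fun c =>
    trace_eq_ofReal_re_of_transpose_eq_conjTranspose
      (ofFn_prod_transpose_eq_conjTranspose fun k => hX (c k))
  have hqC : ∀ c : Fin N → C, (List.ofFn fun k => Y (c k)).prod.trace = (q c : ℂ) := fun c =>
    trace_eq_ofReal_re_of_transpose_eq_conjTranspose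
      (ofFn_prod_transpose_eq_conjTranspose fun k => hY (c k))
  -- the three traces as sums over words
  have hXY : (((∑ a, X a ⊗ₖ Y a) ^ N).trace).re = ∑ c : Fin N → C, p c * q c := by
    rw [sum_pow_eq_sum_ofFn_prod, trace_sum, Complex.re_sum]
    refine sum_congr rfl fun c _ => ?_
    rw [ofFn_prod_kronecker, trace_kronecker, hpC, hqC, ← Complex.ofReal_mul, Complex.ofReal_re]
  have hXX : (((∑ a, X a ⊗ₖ X a) ^ N).trace).re = ∑ c : Fin N → C, p c * p c := by
    rw [sum_pow_eq_sum_ofFn_prod, trace_sum, Complex.re_sum]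
    refine sum_congr rfl fun c _ => ?_
    rw [ofFn_prod_kronecker, trace_kronecker, hpC, ← Complex.ofReal_mul, Complex.ofReal_re]
  have hYY : (((∑ a, Y a ⊗ₖ Y a) ^ N).trace).re = ∑ c : Fin N → C, q c * q c := by
    rw [sum_pow_eq_sum_ofFn_prod, trace_sum, Complex.re_sum]
    refine sum_congr rfl fun c _ => ?_
    rw [ofFn_prod_kronecker, trace_kronecker, hqC, ← Complex.ofReal_mul, Complex.ofReal_re]
  rw [hXY, hXX, hYY]
  -- Cauchy–Schwarz
  have hCS := Finset.sum_mul_sq_le_sq_mul_sq (univ : Finset (Fin N → C)) p q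
  have hpp : 0 ≤ ∑ c : Fin N → C, p c * p c := sum_nonneg fun c _ => mul_self_nonneg _
  have hqq : 0 ≤ ∑ c : Fin N → C, q c * q c := sum_nonneg fun c _ => mul_self_nonneg _
  calc ∑ c : Fin N → C, p c * q c ≤ |∑ c : Fin N → C, p c * q c| := le_abs_self _
    _ ≤ Real.sqrt ((∑ c : Fin N → C, p c * p c) * ∑ c : Fin N → C, q c * q c) := by
        refine Real.abs_le_sqrt ?_
        simpa only [sq] using hCS
    _ = Real.sqrt (∑ c : Fin N → C, p c * p c) * Real.sqrt (∑ c : Fin N → C, q c * q c) :=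
        Real.sqrt_mul hpp _

/-! ### The limit: exponentials of Kronecker sums -/

section Exp

variable [DecidableEq m] [DecidableEq n]

omit [Fintype m] [Fintype n] [DecidableEq m] [DecidableEq n] in
/-- `(r • X) ⊗ (s • Y) = (r s) • (X ⊗ Y)`. [folklore] -/
theorem smul_kronecker_smul (r s : ℂ) (X : Matrix m m ℂ) (Y : Matrix n n ℂ) :
    (r • X) ⊗ₖ (s • Y) = (r * s) • (X ⊗ₖ Y) := by
  rw [smul_kronecker, kronecker_smul, smul_smul, mul_comm]

omit [Fintype m] [Fintype n] in
/-- The Euler approximant of `exp(A⊗1 + 1⊗B + ΣᵢMᵢ⊗Nᵢ)` as a separable sum: with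
`X_none = 1 + A/N`, `X_{some i} = N^{-1/2} Mᵢ` (and `Y` likewise),
`Σₐ Xₐ⊗Yₐ = (1 + A/N)⊗(1 + B/N) + N⁻¹ ΣᵢMᵢ⊗Nᵢ`. [cite: LSSY2005, Ch. 11 (11.5)] -/
theorem sum_option_kronecker_approximant {ι : Type*} [Fintype ι] (A : Matrix m m ℂ)
    (B : Matrix n n ℂ) (M : ι → Matrix m m ℂ) (Nn : ι → Matrix n n ℂ) (N : ℕ) :
    (∑ a : Option ι,
        (Option.elim a ((1 : Matrix m m ℂ) + ((N : ℂ))⁻¹ • A)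
            (fun i => (((Real.sqrt N)⁻¹ : ℝ) : ℂ) • M i)) ⊗ₖ
          (Option.elim a ((1 : Matrix n n ℂ) + ((N : ℂ))⁻¹ • B)
            (fun i => (((Real.sqrt N)⁻¹ : ℝ) : ℂ) • Nn i))) =
      ((1 : Matrix m m ℂ) + ((N : ℂ))⁻¹ • A) ⊗ₖ ((1 : Matrix n n ℂ) + ((N : ℂ))⁻¹ • B) +
        ((N : ℂ))⁻¹ • ∑ i, M i ⊗ₖ Nn i := by
  rw [Fintype.sum_option]
  simp only [Option.elim_none, Option.elim_some]
  congr 1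
  rw [Finset.smul_sum]
  refine sum_congr rfl fun i _ => ?_
  rw [smul_kronecker_smul, ← Complex.ofReal_mul, ← mul_inv, Real.mul_self_sqrt (Nat.cast_nonneg N),
    Complex.ofReal_inv, Complex.ofReal_natCast]

omit [Fintype m] [Fintype n] in
/-- The Euler approximant differs from `1 + Z/N`, `Z = A⊗1 + 1⊗B + ΣᵢMᵢ⊗Nᵢ`, by `N⁻²(A⊗B)`.
[folklore] -/
theorem approximant_sub_one_add {ι : Type*} [Fintype ι] (A : Matrix m m ℂ)
    (B : Matrix n n ℂ) (M : ι → Matrix m m ℂ) (Nn : ι → Matrix n n ℂ) (N : ℕ) :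
    ((1 : Matrix m m ℂ) + ((N : ℂ))⁻¹ • A) ⊗ₖ ((1 : Matrix n n ℂ) + ((N : ℂ))⁻¹ • B) +
        ((N : ℂ))⁻¹ • ∑ i, M i ⊗ₖ Nn i -
      (1 + ((N : ℂ))⁻¹ • (A ⊗ₖ (1 : Matrix n n ℂ) + (1 : Matrix m m ℂ) ⊗ₖ B + ∑ i, M i ⊗ₖ Nn i)) =
      (((N : ℂ))⁻¹ * ((N : ℂ))⁻¹) • (A ⊗ₖ B) := by
  rw [add_kronecker, kronecker_add, kronecker_add, one_kronecker_one, kronecker_smul,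
    smul_kronecker, smul_kronecker, kronecker_smul, smul_smul, smul_add, smul_add]
  abel

omit [Fintype m] in
/-- `1 + N⁻¹W` is real if `W` is. [folklore] -/
theorem transpose_eq_conjTranspose_one_add_inv_smul {W : Matrix m m ℂ} (hW : Wᵀ = Wᴴ) (N : ℕ) :
    ((1 : Matrix m m ℂ) + ((N : ℂ))⁻¹ • W)ᵀ = ((1 : Matrix m m ℂ) + ((N : ℂ))⁻¹ • W)ᴴ := by
  rw [transpose_add, conjTranspose_add, transpose_one, conjTranspose_one, transpose_smul,
    conjTranspose_smul, hW]
  congr 2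
  rw [Complex.star_def, map_inv₀, Complex.conj_natCast]

omit [Fintype m] [DecidableEq m] in
/-- Real scalar multiples of real matrices are real. [folklore] -/
theorem transpose_eq_conjTranspose_ofReal_smul' {W : Matrix m m ℂ} (hW : Wᵀ = Wᴴ) (r : ℝ) :
    ((r : ℂ) • W)ᵀ = ((r : ℂ) • W)ᴴ := by
  rw [transpose_smul, conjTranspose_smul, hW, Complex.star_def, Complex.conj_ofReal]

variable [Nonempty m] [Nonempty n]

/-- **Convergence of the Euler approximants** (`Matrix.Norms.Operator` structure; the limit does
not depend on the norm): `[(1 + A/N)⊗(1 + B/N) + N⁻¹ΣᵢMᵢ⊗Nᵢ]^N → exp(A⊗1 + 1⊗B + ΣᵢMᵢ⊗Nᵢ)`.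
[LSSY2005] Ch. 11 (11.5) ("Using the Trotter product formula"); Reed–Simon I, Thm. VIII.29.
[cite: LSSY2005, Ch. 11 (11.5)] [cite: ReedSimonI1980, Theorem VIII.29] -/
theorem tendsto_approximant_pow {ι : Type*} [Fintype ι] (A : Matrix m m ℂ)
    (B : Matrix n n ℂ) (M : ι → Matrix m m ℂ) (Nn : ι → Matrix n n ℂ) :
    Tendsto (fun N : ℕ => (((1 : Matrix m m ℂ) + ((N : ℂ))⁻¹ • A) ⊗ₖ
        ((1 : Matrix n n ℂ) + ((N : ℂ))⁻¹ • B) + ((N : ℂ))⁻¹ • ∑ i, M i ⊗ₖ Nn i) ^ N) atTop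
      (𝓝 (exp (A ⊗ₖ (1 : Matrix n n ℂ) + (1 : Matrix m m ℂ) ⊗ₖ B + ∑ i, M i ⊗ₖ Nn i))) := by
  letI : NormedRing (Matrix (m × n) (m × n) ℂ) := Matrix.linftyOpNormedRing
  letI : NormedAlgebra ℂ (Matrix (m × n) (m × n) ℂ) := Matrix.linftyOpNormedAlgebra
  haveI : NormOneClass (Matrix (m × n) (m × n) ℂ) := Matrix.linfty_opNormOneClass
  set Z := A ⊗ₖ (1 : Matrix n n ℂ) + (1 : Matrix m m ℂ) ⊗ₖ B + ∑ i, M i ⊗ₖ Nn i with hZ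
  refine tendsto_pow_exp_of_norm_sub_le (𝕂 := ℂ) Z (C := ‖A ⊗ₖ B‖) fun N hN => ?_
  rw [hZ, approximant_sub_one_add, norm_smul, norm_mul, norm_inv, Complex.norm_natCast,
    ← mul_inv, inv_mul_eq_div, sq]

/-- **The Dyson–Lieb–Simon trace inequality** ([DLS1978] Lemma 4.1, eq. (45), with the squares
`-(Cᵢ⊗1 - 1⊗Dᵢ)²` expanded; [LSSY2005] Ch. 11 (11.14)–(11.19)): for REAL square matrices
`A, Mᵢ` (size `m`) and `B, Nᵢ` (size `n`),
`Re Tr exp(A⊗1 + 1⊗B + ΣᵢMᵢ⊗Nᵢ) ≤ (Re Tr exp(A⊗1 + 1⊗A + ΣᵢMᵢ⊗Mᵢ))^{1/2} (Re Tr exp(B⊗1 + 1⊗B + ΣᵢNᵢ⊗Nᵢ))^{1/2}`.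
Proof: `trace_pow_kroneckerSum_le` for the Euler approximants (`sum_option_kronecker_approximant`)
and the product formula `tendsto_approximant_pow`. (DLS assume `A, B, Cᵢ` self-adjoint; only
reality is used.) [cite: DLS1978, Lemma 4.1] [cite: LSSY2005, Ch. 11 (11.17)–(11.19)] -/
theorem trace_exp_kroneckerSum_le {ι : Type*} [Fintype ι] {A : Matrix m m ℂ}
    {B : Matrix n n ℂ} {M : ι → Matrix m m ℂ} {Nn : ι → Matrix n n ℂ} (hA : Aᵀ = Aᴴ)
    (hB : Bᵀ = Bᴴ) (hM : ∀ i, (M i)ᵀ = (M i)ᴴ) (hN : ∀ i, (Nn i)ᵀ = (Nn i)ᴴ) :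
    (exp (A ⊗ₖ (1 : Matrix n n ℂ) + (1 : Matrix m m ℂ) ⊗ₖ B + ∑ i, M i ⊗ₖ Nn i)).trace.re ≤
      Real.sqrt (exp (A ⊗ₖ (1 : Matrix m m ℂ) + (1 : Matrix m m ℂ) ⊗ₖ A +
          ∑ i, M i ⊗ₖ M i)).trace.re *
        Real.sqrt (exp (B ⊗ₖ (1 : Matrix n n ℂ) + (1 : Matrix n n ℂ) ⊗ₖ B +
          ∑ i, Nn i ⊗ₖ Nn i)).trace.re := by
  -- the approximating families
  set X : ℕ → Option ι → Matrix m m ℂ := fun N a =>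
    Option.elim a ((1 : Matrix m m ℂ) + ((N : ℂ))⁻¹ • A) (fun i => (((Real.sqrt N)⁻¹ : ℝ) : ℂ) • M i)
    with hXdef
  set Y : ℕ → Option ι → Matrix n n ℂ := fun N a =>
    Option.elim a ((1 : Matrix n n ℂ) + ((N : ℂ))⁻¹ • B) (fun i => (((Real.sqrt N)⁻¹ : ℝ) : ℂ) • Nn i)
    with hYdef
  -- reality
  have hX : ∀ N a, (X N a)ᵀ = (X N a)ᴴ := by
    intro N a
    rcases a with _ | i
    · exact transpose_eq_conjTranspose_one_add_inv_smul hA N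
    · exact transpose_eq_conjTranspose_ofReal_smul' (hM i) _
  have hY : ∀ N a, (Y N a)ᵀ = (Y N a)ᴴ := by
    intro N a
    rcases a with _ | i
    · exact transpose_eq_conjTranspose_one_add_inv_smul hB N
    · exact transpose_eq_conjTranspose_ofReal_smul' (hN i) _
  -- the inequality for every `N`
  have hN : ∀ N : ℕ, (((∑ a, X N a ⊗ₖ Y N a) ^ N).trace).re ≤
      Real.sqrt (((∑ a, X N a ⊗ₖ X N a) ^ N).trace).re *
        Real.sqrt (((∑ a, Y N a ⊗ₖ Y N a) ^ N).trace).re :=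
    fun N => trace_pow_kroneckerSum_le (hX N) (hY N) N
  -- the three limits
  have hXY : Tendsto (fun N : ℕ => (((∑ a, X N a ⊗ₖ Y N a) ^ N).trace).re) atTop
      (𝓝 (exp (A ⊗ₖ (1 : Matrix n n ℂ) + (1 : Matrix m m ℂ) ⊗ₖ B + ∑ i, M i ⊗ₖ Nn i)).trace.re) := by
    have h := tendsto_approximant_pow A B M Nn
    have h2 := (Complex.continuous_re.tendsto _).comp
      (((Matrix.traceLinearMap (m × n) ℂ ℂ).continuous_of_finiteDimensional.tendsto _).comp h)
    refine h2.congr fun N => ?_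
    simp only [Function.comp_apply, Matrix.traceLinearMap_apply, hXdef, hYdef,
      sum_option_kronecker_approximant]
  have hXX : Tendsto (fun N : ℕ => Real.sqrt (((∑ a, X N a ⊗ₖ X N a) ^ N).trace).re) atTop
      (𝓝 (Real.sqrt (exp (A ⊗ₖ (1 : Matrix m m ℂ) + (1 : Matrix m m ℂ) ⊗ₖ A +
        ∑ i, M i ⊗ₖ M i)).trace.re)) := by
    have h := tendsto_approximant_pow A A M M
    have h2 := ((Real.continuous_sqrt.comp Complex.continuous_re).tendsto _).comp
      (((Matrix.traceLinearMap (m × m) ℂ ℂ).continuous_of_finiteDimensional.tendsto _).comp h)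
    refine h2.congr fun N => ?_
    simp only [Function.comp_apply, Matrix.traceLinearMap_apply, hXdef,
      sum_option_kronecker_approximant]
  have hYY : Tendsto (fun N : ℕ => Real.sqrt (((∑ a, Y N a ⊗ₖ Y N a) ^ N).trace).re) atTop
      (𝓝 (Real.sqrt (exp (B ⊗ₖ (1 : Matrix n n ℂ) + (1 : Matrix n n ℂ) ⊗ₖ B +
        ∑ i, Nn i ⊗ₖ Nn i)).trace.re)) := by
    have h := tendsto_approximant_pow B B Nn Nn
    have h2 := ((Real.continuous_sqrt.comp Complex.continuous_re).tendsto _).comp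
      (((Matrix.traceLinearMap (n × n) ℂ ℂ).continuous_of_finiteDimensional.tendsto _).comp h)
    refine h2.congr fun N => ?_
    simp only [Function.comp_apply, Matrix.traceLinearMap_apply, hYdef,
      sum_option_kronecker_approximant]
  exact le_of_tendsto_of_tendsto' hXY (hXX.mul hYY) hN

end Exp

end Matrix
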